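import Summits.Langlands.Langlands.Theorems.IrreducibilityBySelfDualityIrreducibleOffSectorArtinType
import Literature.NumberTheory.GaloisRepresentations.WeilLAdicCharacterProofs
import Literature.NumberTheory.GaloisRepresentations.FramedRepTwist
import Literature.NumberTheory.GaloisRepresentations.ArtinCharacterReciprocity
import Literature.NumberTheory.GaloisRepresentations.HeckeCharacterCofiniteProofs
import HarnessLib

/-!
# `IrreducibleOffSector` is closed under algebraic twists; the Galois-type region up to a twist
(crux stmt-Langlands-14329 `IrreducibilityBySelfDuality.IrreducibleOffSector`, route
`route-Langlands-IrreducibilityBySelfDuality`, line `Sketch`; `--supports` file, lead c3)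

The conclusion of the crux for an automorphic representation datum `π` of `GL_n(𝔸_K)` at `(ℓ, ι)` —
"every `ρ : Γ_K →ₜ* GL_n(ℚ̄_ℓ)` Satake–Frobenius compatible with `(π, ι)` at almost all places is
irreducible" — is **stable under twisting by algebraic Hecke characters**: if it holds for `π` and
`π'` is the twist `π ⊗ η` at the Satake level (`t_{π',v} = η(ϖ_v) t_{π,v}` for almost all `v`) for a
Hecke character `η` of type `A₀`, it holds for `π'`.  Proof: Weil's `ℓ`-adic character `r_η` of `η`
(`HeckeCharacter.IsAlgebraic.exists_lAdic`: unramified with arithmetic Frobenius `ι⁻¹(η(ϖ_v))⁻¹` at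
almost all `v`) untwists any avatar `ρ'` of `π'` to an avatar `ρ' ⊗ r_η⁻¹` of `π`
(`charpoly_smul_eq_prod_of_charpoly_eq_prod`: the characteristic polynomial of `c · M` has the roots of
that of `M` multiplied by `c`), which is irreducible by hypothesis, and twisting by a character does
not change the lattice of subrepresentations (`isIrreducible_of_forall_exists_smul_eq`).

* `isIrreducible_avatar_of_satakeTwist` — the closure statement (every `n`, `K`, `ℓ`, `ι`);
* `isIrreducible_of_isPiOfArtinRep_satakeTwist` — corollary with the Galois-type region
  (`isIrreducible_of_isPiOfArtinRep`, p119699): if `π' ≃ π(σ) ⊗ η` at the Satake level for an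
  irreducible Artin `σ` and an algebraic `η` (e.g. a CM form of weight one twisted by an algebraic
  Grössencharakter, in any rank), every a.e.-compatible avatar of `π'` is irreducible — unconditional.

References: A. Weil, *On a certain type of characters of the idèle-class group …* (1956) §1–2;
J.-P. Serre, *Abelian ℓ-adic representations* (1968), Ch. II §2.7–2.8, Ch. III §2.3; P. Deligne,
J.-P. Serre, ASENS 7 (1974), 4.4 (twists) and Lemme 3.2; D. Ramakrishnan, *Irreducibility and
cuspidality* (2008), Introduction.
-/

noncomputable section

-- `Summit.Langlands.Langlands.…` (summit = sub-problem name, D-0017 layout) trips `dupNamespace`.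
set_option linter.dupNamespace false

open scoped NumberField Classical Polynomial Matrix
open Filter IsDedekindDomain Polynomial
open Literature.NumberTheory.Automorphic Literature.NumberTheory.GaloisRepresentations

namespace Summit.Langlands.Langlands.Theorems.IrreducibleOffSector

/-! ## 1. Linear algebra: characteristic polynomial of a scalar multiple; subrepresentations of twists -/

section LinearAlgebra

variable {F : Type*} [Field F]

/-- **Characteristic polynomial of a scalar multiple.**  If `charpoly M = ∏_{b ∈ s} (X - b)` and
`c ≠ 0`, then `charpoly (c • M) = ∏_{b ∈ s} (X - c b)`: the characteristic matrix of `c • M` is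
`c` times the image of that of `M` under `X ↦ c⁻¹ X` (`RingHom.map_det`, `Matrix.det_smul`).
[folklore] -/
theorem charpoly_smul_eq_prod_of_charpoly_eq_prod {m : Type*} [Fintype m] [DecidableEq m]
    {M : Matrix m m F} {s : Multiset F} (h : M.charpoly = (s.map fun b => X - C b).prod)
    {c : F} (hc : c ≠ 0) :
    (c • M).charpoly = (s.map fun b => X - C (c * b)).prod := by
  have hcard : Multiset.card s = Fintype.card m := by
    have := congrArg natDegree h
    rwa [Matrix.charpoly_natDegree_eq_dim, natDegree_multiset_prod_X_sub_C_eq_card, eq_comm] at this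
  set φ : F[X] →+* F[X] := Polynomial.compRingHom (C c⁻¹ * X) with hφ
  -- the characteristic matrix of `c • M`
  have hmat : Matrix.charmatrix (c • M) = C c • φ.mapMatrix (Matrix.charmatrix M) := by
    ext i j
    by_cases hij : i = j
    · subst hij
      simp only [Matrix.charmatrix_apply_eq, Matrix.smul_apply, smul_eq_mul, RingHom.mapMatrix_apply,
        Matrix.map_apply, hφ, Polynomial.coe_compRingHom_apply, sub_comp, X_comp, C_comp]
      rw [mul_sub, ← mul_assoc, ← C_mul, mul_inv_cancel₀ hc, C_1, one_mul, C_mul]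
    · simp only [Matrix.charmatrix_apply_ne _ _ _ hij, Matrix.smul_apply, smul_eq_mul,
        RingHom.mapMatrix_apply, Matrix.map_apply, hφ, Polynomial.coe_compRingHom_apply, neg_comp,
        C_comp, C_mul, mul_neg]
  -- distribute the scalar `C c ^ card s` over the factors
  have hprod : ∀ t : Multiset F, C c ^ Multiset.card t *
      (t.map (φ ∘ fun b => X - C b)).prod = (t.map fun b => X - C (c * b)).prod := by
    intro t
    induction t using Multiset.induction_on with
    | empty => simp
    | cons a t ih =>
      rw [Multiset.card_cons, pow_succ, Multiset.map_cons, Multiset.prod_cons, Multiset.map_cons,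
        Multiset.prod_cons, ← ih]
      have e1 : (φ ∘ fun b => X - C b) a = C c⁻¹ * X - C a := by
        simp only [Function.comp_apply, hφ, Polynomial.coe_compRingHom_apply, sub_comp, X_comp, C_comp]
      rw [e1]
      have e2 : C c * (C c⁻¹ * X - C a) = X - C (c * a) := by
        rw [mul_sub, ← mul_assoc, ← C_mul, mul_inv_cancel₀ hc, C_1, one_mul, C_mul]
      rw [← e2]
      ring
  unfold Matrix.charpoly
  rw [hmat, Matrix.det_smul, ← RingHom.map_det, ← Matrix.charpoly, h, map_multiset_prod,
    Multiset.map_map, ← hcard]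
  exact hprod s

variable {G : Type*} [Monoid G] {k : Type*} [Field k] {V : Type*} [AddCommGroup V] [Module k V]

/-- **A representation and its twists by characters have the same subrepresentations**: if
`ρB g = c_g • ρA g` with `c_g ≠ 0` for every `g`, then `ρA` irreducible ⇒ `ρB` irreducible
(Mathlib: the lattice of subrepresentations is simple; the two lattices have the same carriers).
[folklore] -/
theorem isIrreducible_of_forall_exists_smul_eq {ρA ρB : Representation k G V}
    (h : ∀ g : G, ∃ c : k, c ≠ 0 ∧ ∀ v : V, ρB g v = c • ρA g v) (hA : ρA.IsIrreducible) :
    ρB.IsIrreducible := by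
  haveI := hA
  -- transport of carriers in both directions
  let toA : Subrepresentation ρB → Subrepresentation ρA := fun W =>
    ⟨W.toSubmodule, fun g v hv => by
      obtain ⟨c, hc, hcv⟩ := h g
      have h1 : ρB g v ∈ W.toSubmodule := W.apply_mem_toSubmodule g hv
      rw [hcv v] at h1
      have h2 := W.toSubmodule.smul_mem c⁻¹ h1
      rwa [smul_smul, inv_mul_cancel₀ hc, one_smul] at h2⟩
  have htoA : ∀ W, (toA W).toSubmodule = W.toSubmodule := fun W => rfl
  have hbtA : (⊥ : Subrepresentation ρA) ≠ ⊤ := bot_ne_top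
  refine { toNontrivial := ⟨⟨⊥, ⊤, fun hbt => hbtA ?_⟩⟩, eq_bot_or_eq_top := fun W => ?_ }
  · apply Subrepresentation.toSubmodule_injective
    have := congrArg Subrepresentation.toSubmodule hbt
    exact this
  · rcases eq_bot_or_eq_top (toA W) with h0 | h1
    · left
      apply Subrepresentation.toSubmodule_injective
      rw [← htoA W, h0]
      rfl
    · right
      apply Subrepresentation.toSubmodule_injective
      rw [← htoA W, h1]
      rfl

end LinearAlgebra

/-! ## 2. Closure of the crux's conclusion under algebraic twists -/

section Twist

variable {K : Type} [Field K] [NumberField K] {n ℓ : ℕ} [Fact ℓ.Prime]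

/-- Only finitely many finite places of a number field lie above `ℓ`. [folklore] -/
theorem eventually_natCast_not_mem_asIdeal (K : Type) [Field K] [NumberField K] {p : ℕ} (hp : p ≠ 0) :
    ∀ᶠ v : HeightOneSpectrum (𝓞 K) in cofinite, ((p : ℕ) : 𝓞 K) ∉ v.asIdeal := by
  rw [Filter.eventually_cofinite]
  have hI : Ideal.span {((p : ℕ) : 𝓞 K)} ≠ ⊥ := by
    rw [Ne, Ideal.span_singleton_eq_bot]
    exact_mod_cast hp
  refine (Ideal.finite_factors hI).subset fun v hv => ?_
  simp only [Set.mem_setOf_eq, not_not] at hv ⊢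
  exact (Ideal.dvd_span_singleton).mpr hv

/-- **Weil's `ℓ`-adic character of an algebraic Hecke character, as a continuous character**
`θ : Γ_K →ₜ* ℚ̄_ℓˣ` (the determinant of the rank-one representation of
`HeckeCharacter.IsAlgebraic.exists_lAdic`): at almost every finite place `v`, `θ` kills the inertia
groups above `v` and takes the value `ι⁻¹(η(ϖ_v))⁻¹` on the arithmetic Frobenii above `v`.
[cite: Weil1956, §1–§2] [cite: SerreAbelianLadic1968, Ch. II §2.7–2.8] -/
theorem exists_character_of_isAlgebraic {η : HeckeCharacter K} (hη : η.IsAlgebraic)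
    (ι : PadicAlgCl ℓ ≃+* ℂ) :
    ∃ θ : Field.absoluteGaloisGroup K →ₜ* (PadicAlgCl ℓ)ˣ,
      ∀ᶠ v : HeightOneSpectrum (𝓞 K) in cofinite,
        (∀ 𝔓 ∈ v.primesAbove, ∀ g ∈ 𝔓.inertia (Field.absoluteGaloisGroup K), θ g = 1) ∧
        ∀ 𝔓 ∈ v.primesAbove, ∀ g : Field.absoluteGaloisGroup K, IsArithFrobAt (𝓞 K) g 𝔓 →
          ((θ g : (PadicAlgCl ℓ)ˣ) : PadicAlgCl ℓ) = ι.symm (η.valueAtUniformizer v)⁻¹ := by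
  obtain ⟨r, hr⟩ := hη.exists_lAdic ι
  refine ⟨FramedRep.det r, ?_⟩
  filter_upwards [eventually_natCast_not_mem_asIdeal K (Fact.out : ℓ.Prime).ne_zero,
    HeckeCharacter.isUnramifiedAt_cofinite_holds η] with v hvℓ hvη
  obtain ⟨hur, hcp⟩ := hr v hvℓ hvη
  refine ⟨fun 𝔓 h𝔓 g hg => ?_, fun 𝔓 h𝔓 g hg => ?_⟩
  · rw [FramedRep.det_apply, hur 𝔓 h𝔓 g hg, map_one]
  · have h := (FramedGaloisRep.hasFrobCharpolyAt_iff_of_rank_one r v _).mp hcp 𝔓 h𝔓 g hg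
    rw [FramedRep.det_apply, Matrix.GeneralLinearGroup.val_det_apply, Matrix.det_fin_one, h]

/-- **The conclusion of `IrreducibleOffSector` is closed under algebraic twists** (every rank `n`,
every number field `K`, every `ℓ`, `ι`).  Let `π`, `π'` be automorphic representation data of
`GL_n(𝔸_K)` and `η` an algebraic Hecke character (type `A₀`) with `π' = π ⊗ η` at the Satake level:
at almost every `v`, if `π'` has Satake parameter `α'` then `π` has Satake parameter
`{a' η(ϖ_v)⁻¹}`.  If every `ρ` Satake–Frobenius compatible with `(π, ι)` a.e. is irreducible, then so
is every `ρ'` Satake–Frobenius compatible with `(π', ι)` a.e.: `ρ' ⊗ θ⁻¹` (Weil's `ℓ`-adic character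
`θ` of `η`) is compatible with `π` (`charpoly_smul_eq_prod_of_charpoly_eq_prod`), hence irreducible,
and `ρ' = (ρ' ⊗ θ⁻¹) ⊗ θ` has the same subrepresentations. [cite: Weil1956, §1–§2]
[cite: DeligneSerreASENS1974, 4.4 and Lemme 3.2] -/
theorem isIrreducible_avatar_of_satakeTwist {K : Type} [Field K] [NumberField K] {n ℓ : ℕ}
    [Fact ℓ.Prime] {hcpt hcpt' : isCompact_glFiniteIntegralLevel n K}
    (π : AutomorphicRepData (AutomorphyDatum.gl n K hcpt))
    (π' : AutomorphicRepData (AutomorphyDatum.gl n K hcpt')) {η : HeckeCharacter K}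
    (hη : η.IsAlgebraic)
    (hTw : ∀ᶠ v : HeightOneSpectrum (𝓞 K) in cofinite, ∀ α' : Multiset ℂ,
      π'.HasSatakeParamAt v α' → π.HasSatakeParamAt v (α'.map (· * (η.valueAtUniformizer v)⁻¹)))
    (ι : PadicAlgCl ℓ ≃+* ℂ)
    (hπ : ∀ ρ : FramedGaloisRep K (PadicAlgCl ℓ) n,
      (∀ᶠ v : HeightOneSpectrum (𝓞 K) in cofinite, SatakeFrobCompatibleAt ι π ρ v) →
        ρ.toGaloisRep.IsIrreducible)
    (ρ' : FramedGaloisRep K (PadicAlgCl ℓ) n)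
    (hρ' : ∀ᶠ v : HeightOneSpectrum (𝓞 K) in cofinite, SatakeFrobCompatibleAt ι π' ρ' v) :
    ρ'.toGaloisRep.IsIrreducible := by
  obtain ⟨θ, hθ⟩ := exists_character_of_isAlgebraic (ℓ := ℓ) hη ι
  have hinv : ∀ g, (θ⁻¹) g = (θ g)⁻¹ := fun g => rfl
  -- the untwisted avatar `ρ := ρ' ⊗ θ⁻¹` is compatible with `π`
  set ρ : FramedGaloisRep K (PadicAlgCl ℓ) n := FramedRep.twist ρ' θ⁻¹ with hρdef
  have hρ : ∀ᶠ v : HeightOneSpectrum (𝓞 K) in cofinite, SatakeFrobCompatibleAt ι π ρ v := by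
    filter_upwards [hρ', hTw, hθ] with v hv hvTw hvθ
    obtain ⟨α', hα', hur', hcp'⟩ := hv
    obtain ⟨hθur, hθcp⟩ := hvθ
    refine ⟨α'.map (· * (η.valueAtUniformizer v)⁻¹), hvTw α' hα', fun 𝔓 h𝔓 g hg => ?_,
      fun 𝔓 h𝔓 g hg => ?_⟩
    · -- unramified: both factors are trivial on inertia
      rw [hρdef, FramedRep.twist_apply, hur' 𝔓 h𝔓 g hg, mul_one, hinv, hθur 𝔓 h𝔓 g hg, inv_one,
        map_one]
    · -- Frobenius: `charpoly (θ(g)⁻¹ • ρ'(g)) = ∏ (X - ι⁻¹(η(ϖ_v)) ι⁻¹(a'⁻¹))`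
      have hηv : η.valueAtUniformizer v ≠ 0 := Units.ne_zero _
      have hc : ((θ⁻¹ g : (PadicAlgCl ℓ)ˣ) : PadicAlgCl ℓ) = ι.symm (η.valueAtUniformizer v) := by
        rw [hinv, Units.val_inv_eq_inv_val, hθcp 𝔓 h𝔓 g hg, ← map_inv₀, inv_inv]
      have hc0 : ((θ⁻¹ g : (PadicAlgCl ℓ)ˣ) : PadicAlgCl ℓ) ≠ 0 := Units.ne_zero _
      have hM := hcp' 𝔓 h𝔓 g hg
      unfold FramedRep.charpoly at hM ⊢
      have hM' : ((ρ' g : GL (Fin n) (PadicAlgCl ℓ)) : Matrix (Fin n) (Fin n) (PadicAlgCl ℓ)).charpoly =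
          ((α'.map fun a => ι.symm a⁻¹).map fun b => X - C b).prod := by
        rw [hM, arithFrobPolyOfSatake_one, Multiset.map_map]; rfl
      rw [hρdef, FramedRep.coe_twist_apply, charpoly_smul_eq_prod_of_charpoly_eq_prod hM' hc0, hc,
        arithFrobPolyOfSatake_one, Multiset.map_map, Multiset.map_map]
      refine congrArg Multiset.prod (Multiset.map_congr rfl fun a _ => ?_)
      simp only [Function.comp_apply]
      rw [← map_mul, mul_inv, inv_inv, mul_comm]
  -- hence irreducible, and `ρ' = ρ ⊗ θ`
  have hirr : ρ.toGaloisRep.IsIrreducible := hπ ρ hρ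
  have hρ'eq : ρ' = FramedRep.twist ρ θ := by
    rw [hρdef, FramedRep.twist_twist, mul_inv_cancel, FramedRep.twist_one]
  change ρ'.toRepresentation.IsIrreducible
  refine isIrreducible_of_forall_exists_smul_eq (ρA := ρ.toRepresentation) (fun g => ?_) hirr
  refine ⟨((θ g : (PadicAlgCl ℓ)ˣ) : PadicAlgCl ℓ), Units.ne_zero _, fun x => ?_⟩
  rw [FramedRep.toRepresentation_apply_apply, FramedRep.toRepresentation_apply_apply]
  conv_lhs => rw [hρ'eq]
  rw [FramedRep.coe_twist_apply, Matrix.smul_mulVec]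

/-- **The Galois-type region up to an algebraic twist** (every rank, every number field,
unconditional): if `π'` is, at the Satake level, the twist by an algebraic Hecke character `η` of an
automorphic representation datum `π = π(σ)` of Galois type with `σ` an IRREDUCIBLE Artin
representation, then every `ρ' : Γ_K →ₜ* GL_n(ℚ̄_ℓ)` Satake–Frobenius compatible with `(π', ι)` a.e. is
irreducible (`isIrreducible_avatar_of_satakeTwist` with `isIrreducible_of_isPiOfArtinRep`, p119699).
[cite: DeligneSerreASENS1974, Lemme 3.2] [cite: Tunnell1981, p. 173] [cite: Weil1956, §1–§2] -/
theorem isIrreducible_of_isPiOfArtinRep_satakeTwist {K : Type} [Field K] [NumberField K] {n ℓ : ℕ}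
    [Fact ℓ.Prime] {hcpt hcpt' : isCompact_glFiniteIntegralLevel n K}
    (π : AutomorphicRepData (AutomorphyDatum.gl n K hcpt)) {σ : FramedArtinRep K n}
    (hσ : σ.toGaloisRep.IsIrreducible) (hπ : IsPiOfArtinRep σ π)
    (π' : AutomorphicRepData (AutomorphyDatum.gl n K hcpt')) {η : HeckeCharacter K}
    (hη : η.IsAlgebraic)
    (hTw : ∀ᶠ v : HeightOneSpectrum (𝓞 K) in cofinite, ∀ α' : Multiset ℂ,
      π'.HasSatakeParamAt v α' → π.HasSatakeParamAt v (α'.map (· * (η.valueAtUniformizer v)⁻¹)))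
    (ι : PadicAlgCl ℓ ≃+* ℂ) (ρ' : FramedGaloisRep K (PadicAlgCl ℓ) n)
    (hρ' : ∀ᶠ v : HeightOneSpectrum (𝓞 K) in cofinite, SatakeFrobCompatibleAt ι π' ρ' v) :
    ρ'.toGaloisRep.IsIrreducible :=
  isIrreducible_avatar_of_satakeTwist π π' hη hTw ι
    (fun ρ hρ => isIrreducible_of_isPiOfArtinRep π hσ hπ ι ρ hρ) ρ' hρ'

end Twist

end Summit.Langlands.Langlands.Theorems.IrreducibleOffSector

end
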